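import Mathlib
import Literature.Analysis.Calculus.TwoVariablePartials
import HarnessLib

/-!
# Finite linear combinations of `C²` functions: second derivatives, residuals, energy densities

Analysis/PDE support file (everything proved). Bookkeeping for the span of the true kernel
elements in the far-side channel estimate of `FixedModeChannels` (route PhotonSphereChannels,
stmt-FinalStateConjecture-10048): `iteratedDeriv 2` and the wave residual
`p_tt − p_xx + W p` of a finite combination `Σ_m a_m B_m` are the combinations of those of the
`B_m` (`iteratedDeriv_two_fun_sum`, `wave1D_residual_sum`), the residual of a `C²` function is
jointly continuous (`continuous_wave1D_residual`), and the energy density of a combination of `N`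
functions is at most `N Σ_m a_m² e[B_m]` (`wave1D_energyDensity_sum_le`, Cauchy–Schwarz).
Folklore.
-/

noncomputable section

namespace Literature.Analysis.PDE

open Set Filter Topology Finset Literature.Analysis.Calculus

/-- `iteratedDeriv 2` of a finite sum of `C²` functions. [folklore] -/
theorem iteratedDeriv_two_fun_sum {ι : Type*} (u : Finset ι) {f : ι → ℝ → ℝ}
    (h : ∀ i ∈ u, ContDiff ℝ 2 (f i)) (x : ℝ) :
    iteratedDeriv 2 (fun y => ∑ i ∈ u, f i y) x = ∑ i ∈ u, iteratedDeriv 2 (f i) x := by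
  rw [iteratedDeriv_eq_iteratedFDeriv, iteratedFDeriv_fun_sum_apply fun i hi => (h i hi).contDiffAt,
    _root_.sum_apply]
  refine Finset.sum_congr rfl fun i _ => ?_
  rw [iteratedDeriv_eq_iteratedFDeriv]

/-- `iteratedDeriv 2` of a finite combination `Σ a_i f_i` of `C²` functions. [folklore] -/
theorem iteratedDeriv_two_fun_lincomb {ι : Type*} (u : Finset ι) {f : ι → ℝ → ℝ} (a : ι → ℝ)
    (h : ∀ i ∈ u, ContDiff ℝ 2 (f i)) (x : ℝ) :
    iteratedDeriv 2 (fun y => ∑ i ∈ u, a i * f i y) x = ∑ i ∈ u, a i * iteratedDeriv 2 (f i) x := by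
  rw [iteratedDeriv_two_fun_sum u (fun i hi => contDiff_const.mul (h i hi)) x]
  refine Finset.sum_congr rfl fun i hi => ?_
  exact iteratedDeriv_const_mul (a i) (h i hi).contDiffAt

/-- Slices of a `C²` function of two variables are `C²`. [folklore] -/
theorem contDiff_two_slices'' {ψ : ℝ → ℝ → ℝ} (hψ : ContDiff ℝ 2 (Function.uncurry ψ)) (t x : ℝ) :
    ContDiff ℝ 2 (fun τ => ψ τ x) ∧ ContDiff ℝ 2 (ψ t) :=
  ⟨hψ.comp (contDiff_id.prodMk contDiff_const), hψ.comp (contDiff_const.prodMk contDiff_id)⟩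

/-- **The residual of a combination.** For `C²` functions `B_m` and coefficients `a_m`,
`resid_W(Σ a_m B_m) = Σ a_m resid_W(B_m)` pointwise. [folklore] -/
theorem wave1D_residual_lincomb {ι : Type*} (u : Finset ι) {B : ι → ℝ → ℝ → ℝ} (a : ι → ℝ)
    (W : ℝ → ℝ) (hB : ∀ m ∈ u, ContDiff ℝ 2 (Function.uncurry (B m))) (t x : ℝ) :
    iteratedDeriv 2 (fun τ => ∑ m ∈ u, a m * B m τ x) t
        - iteratedDeriv 2 (fun y => ∑ m ∈ u, a m * B m t y) x + W x * ∑ m ∈ u, a m * B m t x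
      = ∑ m ∈ u, a m * (iteratedDeriv 2 (fun τ => B m τ x) t - iteratedDeriv 2 (B m t) x
          + W x * B m t x) := by
  rw [iteratedDeriv_two_fun_lincomb u a (fun m hm => (contDiff_two_slices'' (hB m hm) t x).1) t,
    iteratedDeriv_two_fun_lincomb u a (fun m hm => (contDiff_two_slices'' (hB m hm) t x).2) x,
    Finset.mul_sum, ← Finset.sum_sub_distrib, ← Finset.sum_add_distrib]
  refine Finset.sum_congr rfl fun m _ => ?_
  ring

/-- **A finite combination of `C²` functions of two variables is `C²`.** [folklore] -/
theorem contDiff_two_lincomb {ι : Type*} (u : Finset ι) {B : ι → ℝ → ℝ → ℝ} (a : ι → ℝ)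
    (hB : ∀ m ∈ u, ContDiff ℝ 2 (Function.uncurry (B m))) :
    ContDiff ℝ 2 (Function.uncurry fun t x => ∑ m ∈ u, a m * B m t x) := by
  have : (Function.uncurry fun t x => ∑ m ∈ u, a m * B m t x)
      = fun p : ℝ × ℝ => ∑ m ∈ u, a m * Function.uncurry (B m) p := by
    funext p; rfl
  rw [this]
  exact ContDiff.sum fun m hm => contDiff_const.mul (hB m hm)

/-- **The residual of a `C²` function is jointly continuous.** [folklore] -/
theorem continuous_wave1D_residual {W : ℝ → ℝ} (hW : Continuous W) {ψ : ℝ → ℝ → ℝ}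
    (hψ : ContDiff ℝ 2 (Function.uncurry ψ)) :
    Continuous fun p : ℝ × ℝ => iteratedDeriv 2 (fun τ => ψ τ p.2) p.1
      - iteratedDeriv 2 (ψ p.1) p.2 + W p.2 * ψ p.1 p.2 := by
  obtain ⟨ψt, ψx, ψtt, ψtx, ψxx, -, -, hctt, -, hcxx, -, -, -, -, -, -, h1, h2⟩ :=
    exists_partials_of_contDiff_two hψ
  have e : (fun p : ℝ × ℝ => iteratedDeriv 2 (fun τ => ψ τ p.2) p.1
      - iteratedDeriv 2 (ψ p.1) p.2 + W p.2 * ψ p.1 p.2)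
      = fun p => ψtt p.1 p.2 - ψxx p.1 p.2 + W p.2 * ψ p.1 p.2 := by
    funext p; rw [h1, h2]
  rw [e]
  exact (hctt.sub hcxx).add ((hW.comp continuous_snd).mul hψ.continuous)

/-- Cauchy–Schwarz for a combination: `(Σ a_m b_m)² ≤ #u Σ a_m² b_m²`. [folklore] -/
theorem sq_lincomb_le {ι : Type*} (u : Finset ι) (a b : ι → ℝ) :
    (∑ m ∈ u, a m * b m) ^ 2 ≤ u.card * ∑ m ∈ u, a m ^ 2 * b m ^ 2 := by
  have h := sq_sum_le_card_mul_sum_sq (s := u) (f := fun m => a m * b m)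
  simpa [mul_pow] using h

/-- **Energy density of a combination**: `e_W[Σ a_m B_m](t,x) ≤ #u Σ a_m² e_W[B_m](t,x)` for
`C²` functions `B_m` and `W x ≥ 0`. [folklore] -/
theorem wave1D_energyDensity_lincomb_le {ι : Type*} (u : Finset ι) {B : ι → ℝ → ℝ → ℝ}
    (a : ι → ℝ) {W : ℝ → ℝ} (hB : ∀ m ∈ u, ContDiff ℝ 2 (Function.uncurry (B m))) (t x : ℝ)
    (hWx : 0 ≤ W x) :
    deriv (fun τ => ∑ m ∈ u, a m * B m τ x) t ^ 2 + deriv (fun y => ∑ m ∈ u, a m * B m t y) x ^ 2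
        + W x * (∑ m ∈ u, a m * B m t x) ^ 2
      ≤ u.card * ∑ m ∈ u, a m ^ 2 *
          (deriv (fun τ => B m τ x) t ^ 2 + deriv (B m t) x ^ 2 + W x * B m t x ^ 2) := by
  have hd : ∀ m ∈ u, DifferentiableAt ℝ (fun τ => B m τ x) t ∧ DifferentiableAt ℝ (B m t) x :=
    fun m hm => ⟨(contDiff_two_slices'' (hB m hm) t x).1.differentiable (by norm_num) t,
      (contDiff_two_slices'' (hB m hm) t x).2.differentiable (by norm_num) x⟩
  have hD1 : deriv (fun τ => ∑ m ∈ u, a m * B m τ x) t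
      = ∑ m ∈ u, a m * deriv (fun τ => B m τ x) t := by
    have := HasDerivAt.fun_sum (u := u) (A := fun m τ => a m * B m τ x)
      (A' := fun m => a m * deriv (fun τ => B m τ x) t) (x := t)
      fun m hm => ((hd m hm).1.hasDerivAt).const_mul (a m)
    exact this.deriv
  have hD2 : deriv (fun y => ∑ m ∈ u, a m * B m t y) x = ∑ m ∈ u, a m * deriv (B m t) x := by
    have := HasDerivAt.fun_sum (u := u) (A := fun m y => a m * B m t y)
      (A' := fun m => a m * deriv (B m t) x) (x := x)
      fun m hm => ((hd m hm).2.hasDerivAt).const_mul (a m)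
    exact this.deriv
  rw [hD1, hD2]
  have h1 := sq_lincomb_le u a (fun m => deriv (fun τ => B m τ x) t)
  have h2 := sq_lincomb_le u a (fun m => deriv (B m t) x)
  have h3 := sq_lincomb_le u a (fun m => B m t x)
  have h3' := mul_le_mul_of_nonneg_left h3 hWx
  calc (∑ m ∈ u, a m * deriv (fun τ => B m τ x) t) ^ 2 + (∑ m ∈ u, a m * deriv (B m t) x) ^ 2
        + W x * (∑ m ∈ u, a m * B m t x) ^ 2
      ≤ u.card * ∑ m ∈ u, a m ^ 2 * deriv (fun τ => B m τ x) t ^ 2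
        + u.card * ∑ m ∈ u, a m ^ 2 * deriv (B m t) x ^ 2
        + W x * (u.card * ∑ m ∈ u, a m ^ 2 * B m t x ^ 2) := by linarith
    _ = u.card * ∑ m ∈ u, a m ^ 2 *
          (deriv (fun τ => B m τ x) t ^ 2 + deriv (B m t) x ^ 2 + W x * B m t x ^ 2) := by
        rw [Finset.mul_sum, Finset.mul_sum, Finset.mul_sum, Finset.mul_sum, Finset.mul_sum,
          ← Finset.sum_add_distrib, ← Finset.sum_add_distrib]
        refine Finset.sum_congr rfl fun m _ => ?_
        ring

end Literature.Analysis.PDE
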